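import Summits.HodgeConjecture.CorCM.Census.DecicWeil23Pair
import HarnessLib

/-!
# TWO `(2,3)`-types over one decic CM field: the generating PARTS of a balanced configuration of `E × B₁ × B₂` — conjugate
# pairs, Weil SIXFOLD parts of `B_m × E`, the TENFOLD part of `B₁ × B̄₂` — extraction and the induction principle

COR-CM (cell `pub-hodgecm2`), seat b30 gen 22 (2026-08-22); count-neutral own lane DECIC-WEIL-23PAIR, sequel of
`Census/DecicWeil23Pair.lean` (model, notation, DEFECT LAW as there).  Bookkeeping definitions (the part predicates) and
theorems of a finite model; no named fact, no geometry, no `sorry`.  The degree-`10` sibling of `Census/OcticWeil13PairParts`.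

THE PARTS of a configuration `(T, v)`, `v : α → PtD` (an element of `α` is a coordinate `(copy, embedding)` of a product of copies
of `E, B₁, B₂`):
* `IsPairPartD v G` — two points over a conjugate pair of labels `{y, cjD y}` (a divisor weight);
* `IsFivePartD v m b G` — five points, one over each label `(m, a, b)`, `a < 5` (the `B_m`-half of the next two; NOT balanced);
* `IsSixPartD v m b G` — a five part of slot `m`, sign `b` plus ONE point over the curve label `inl b`: a lift of the Weil weight
  `[τ_b] + Σ_{s over τ_b} [s]` of the SIXFOLD `B_m × E` (`k`-signature `(3,3)`, Markman's realm);
* `IsTenPartD v b G` — a five part of slot `0`, sign `b` plus a five part of slot `1`, sign `¬b`: a lift of the Weil weight of the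
  TENFOLD `B₁ × B̄₂` (`k` acting through `ι₁ × ι₂ ∘ conj`, signature `(5,5)`); `E`-free, so NOT a union of sixfold parts.

RESULTS (kernel).  Count functions, splittings (`IsSixPartD.exists_split`, `IsTenPartD.exists_split`), the parts are balanced
(`IsPairPartD.modelBalancedD`, `IsSixPartD.modelBalancedD`, `IsTenPartD.modelBalancedD`: sixty-row checks by `decide`), selection
of parts from the counts (`exists_fivePartD_of_counts`, `exists_pairPartD_of_counts`).  EXTRACTION and the INDUCTION PRINCIPLE are
the sequel `Census/DecicWeil23PairExtraction.lean`.
[cite: Pohlmann1968, Thm 1] [cite: GaoUllmo2025, Thm 3.1] [cite: Milne2020HodgeClassesAV, 1.2 (a) and Thm. 1]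
[cite: MoonenZarhin1995Duke, Thm. 2.4] [cite: Gordon1999HodgeAVSurvey, 5.13 (ii), 9.2.2]

## References
* [Pohlmann1968] Ann. of Math. 88 (1968), Thm 1.  [GaoUllmo2025] J. Inst. Math. Jussieu 25 (2025), Thm 3.1.
  [Milne2020HodgeClassesAV] arXiv:2010.08857, 1.2 (a), Thm. 1.  [MoonenZarhin1995Duke] Duke Math. J. 77 (1995), Thm. 2.4.
  [Gordon1999HodgeAVSurvey] CRM Monogr. 10 (1999), 5.13 (ii), 9.2.2.
-/

namespace Summit.HodgeConjecture.CorCM.Census.DecicWeil23Pair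

open Finset

variable {α : Type*} {c : Bool} {v : α → PtD}

/-! ### The parts -/

/-- **A pair part**: two points over a conjugate pair of labels `{y, cjD y}` (a divisor weight, possibly spread over two copies).
[cite: Gordon1999HodgeAVSurvey, 9.2.2] -/
def IsPairPartD (v : α → PtD) (G : Finset α) : Prop :=
  ∃ y : PtD, G.card = 2 ∧ Set.InjOn v ↑G ∧ G.image v = {y, cjD y}

/-- **A five part of slot `m` and sign `b`**: five points, one over each label `(m, a, b)` — the weight of the eigenline
`⋀⁵ H¹(B_m)_b` (type `(2,3)` or `(3,2)`: NOT a Hodge class; the `B_m`-half of a sixfold or tenfold part). [cite: MoonenZarhin1995Duke, Thm. 2.4] -/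
def IsFivePartD (v : α → PtD) (m : Fin 2) (b : Bool) (G : Finset α) : Prop :=
  G.card = 5 ∧ ∀ a : Fin 5, (G.filter fun x => v x = Sum.inr (m, (a, b))).card = 1

/-- **A Weil SIXFOLD part of slot `m` and sign `b`**: six points, one over the curve label `inl b` and one over each `(m, a, b)` —
a lift of the Weil weight of `B_m × E` (`k`-signature `(3,3)`). [cite: MoonenZarhin1995Duke, Thm. 2.4]
[cite: Gordon1999HodgeAVSurvey, 5.13 (ii)] -/
def IsSixPartD (v : α → PtD) (m : Fin 2) (b : Bool) (G : Finset α) : Prop :=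
  G.card = 6 ∧ (G.filter fun x => v x = Sum.inl b).card = 1 ∧ ∀ a : Fin 5, (G.filter fun x => v x = Sum.inr (m, (a, b))).card = 1

/-- **The Weil TENFOLD part of sign `b`**: ten points, one over each `(0, a, b)` and one over each `(1, a, ¬b)` — a lift of the
Weil weight of the tenfold `B₁ × B̄₂` (`k`-signature `(5,5)`). [cite: MoonenZarhin1995Duke, Thm. 2.4]
[cite: Gordon1999HodgeAVSurvey, 5.13 (ii)] -/
def IsTenPartD (v : α → PtD) (b : Bool) (G : Finset α) : Prop :=
  G.card = 10 ∧ (∀ a : Fin 5, (G.filter fun x => v x = Sum.inr (0, (a, b))).card = 1) ∧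
    ∀ a : Fin 5, (G.filter fun x => v x = Sum.inr (1, (a, !b))).card = 1

/-! ### Count functions -/

/-- The count function of a pair part: `1` on `y` and `cjD y`, `0` elsewhere. [folklore] -/
theorem IsPairPartD.count_eq [DecidableEq α] {G : Finset α} (hG : IsPairPartD v G) : ∃ y : PtD, ∀ z : PtD,
    (G.filter fun x => v x = z).card = if z = y ∨ z = cjD y then 1 else 0 := by
  obtain ⟨y, hcard, hinj, himg⟩ := hG
  refine ⟨y, fun z => ?_⟩
  have hfib : ∀ z, (G.filter fun x => v x = z).card = if z ∈ G.image v then 1 else 0 := by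
    intro z
    split_ifs with hz
    · obtain ⟨x, hx, rfl⟩ := Finset.mem_image.1 hz
      rw [Finset.card_eq_one]
      refine ⟨x, Finset.eq_singleton_iff_unique_mem.2 ⟨Finset.mem_filter.2 ⟨hx, rfl⟩, fun x' hx' => ?_⟩⟩
      exact hinj (Finset.mem_of_mem_filter _ hx') hx (Finset.mem_filter.1 hx').2
    · rw [Finset.card_eq_zero, Finset.filter_eq_empty_iff]
      exact fun x hx hxz => hz (hxz ▸ Finset.mem_image_of_mem v hx)
  rw [hfib z, himg]
  simp only [Finset.mem_insert, Finset.mem_singleton]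

/-- The fibres over pairwise distinct labels `f a` (`f` injective) and one further fibre fit into `G`. [folklore] -/
private theorem sum_fibres_add_le (G : Finset α) {f : Fin 5 → PtD} (hf : Function.Injective f) {z : PtD} (hz : ∀ a, z ≠ f a) :
    ∑ a : Fin 5, (G.filter fun x => v x = f a).card + (G.filter fun x => v x = z).card ≤ G.card := by
  classical
  have hpd : ∀ a ∈ (univ : Finset (Fin 5)), ∀ a' ∈ (univ : Finset (Fin 5)), a ≠ a' →
      Disjoint (G.filter fun x => v x = f a) (G.filter fun x => v x = f a') :=
    fun a _ a' _ haa => Finset.disjoint_filter.2 fun x _ h1 h2 => haa (hf (h1.symm.trans h2))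
  have hdisj : Disjoint ((univ : Finset (Fin 5)).biUnion fun a => G.filter fun x => v x = f a) (G.filter fun x => v x = z) :=
    (Finset.disjoint_biUnion_left _ _ _).2 fun a _ => Finset.disjoint_filter.2 fun x _ h1 h2 => hz a (h2.symm.trans h1)
  rw [← Finset.card_biUnion hpd, ← Finset.card_union_of_disjoint hdisj]
  exact Finset.card_le_card (Finset.union_subset (Finset.biUnion_subset.2 fun a _ => Finset.filter_subset _ _)
    (Finset.filter_subset _ _))

/-- The labels `(m, a, b)`, `a < 5`, are pairwise distinct. [folklore] -/
theorem inr_injective (m : Fin 2) (b : Bool) : Function.Injective fun a : Fin 5 => (Sum.inr (m, (a, b)) : PtD) :=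
  fun a a' h => by simpa using h

/-- The count function of a five part of slot `m`, sign `b`: `1` on the five `(m, a, b)`, `0` elsewhere. [folklore] -/
theorem IsFivePartD.count_eq {m : Fin 2} {b : Bool} {G : Finset α} (hG : IsFivePartD v m b G) (z : PtD) :
    (G.filter fun x => v x = z).card = if ∃ a : Fin 5, z = Sum.inr (m, (a, b)) then 1 else 0 := by
  classical
  obtain ⟨hcard, hB⟩ := hG
  split_ifs with hz
  · obtain ⟨a, rfl⟩ := hz
    exact hB a
  · push Not at hz
    have hle := sum_fibres_add_le (v := v) G (inr_injective m b) hz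
    simp only [hB, Finset.sum_const, Finset.card_univ, Fintype.card_fin, smul_eq_mul, mul_one, hcard] at hle
    omega

/-- The count function of a sixfold part: `1` on `inl b` and on the five `(m, a, b)`, `0` elsewhere. [folklore] -/
theorem IsSixPartD.count_eq {m : Fin 2} {b : Bool} {G : Finset α} (hG : IsSixPartD v m b G) (z : PtD) :
    (G.filter fun x => v x = z).card =
      if z = Sum.inl b then 1 else if ∃ a : Fin 5, z = Sum.inr (m, (a, b)) then 1 else 0 := by
  classical
  obtain ⟨hcard, hE, hB⟩ := hG
  split_ifs with hz hz'
  · rw [hz]; exact hE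
  · obtain ⟨a, rfl⟩ := hz'; exact hB a
  · push Not at hz'
    -- the six known fibres and the fibre of `z` fit into `G`
    have hle := sum_fibres_add_le (v := v) G (inr_injective m b) hz'
    have hle' : ∑ a : Fin 5, (G.filter fun x => v x = Sum.inr (m, (a, b))).card + (G.filter fun x => v x = z).card +
        (G.filter fun x => v x = Sum.inl b).card ≤ G.card := by
      have hpd : ∀ a ∈ (univ : Finset (Fin 5)), ∀ a' ∈ (univ : Finset (Fin 5)), a ≠ a' →
          Disjoint (G.filter fun x => v x = Sum.inr (m, (a, b))) (G.filter fun x => v x = Sum.inr (m, (a', b))) :=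
        fun a _ a' _ haa => Finset.disjoint_filter.2 fun x _ h1 h2 => haa (inr_injective m b (h1.symm.trans h2))
      have hd1 : Disjoint ((univ : Finset (Fin 5)).biUnion fun a => G.filter fun x => v x = Sum.inr (m, (a, b)))
          (G.filter fun x => v x = z) :=
        (Finset.disjoint_biUnion_left _ _ _).2 fun a _ => Finset.disjoint_filter.2 fun x _ h1 h2 => hz' a (h2.symm.trans h1)
      have hd2 : Disjoint (((univ : Finset (Fin 5)).biUnion fun a => G.filter fun x => v x = Sum.inr (m, (a, b))) ∪
          (G.filter fun x => v x = z)) (G.filter fun x => v x = Sum.inl b) := by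
        rw [Finset.disjoint_union_left]
        refine ⟨(Finset.disjoint_biUnion_left _ _ _).2 fun a _ => Finset.disjoint_filter.2 fun x _ h1 h2 => ?_,
          Finset.disjoint_filter.2 fun x _ h1 h2 => hz (h1.symm.trans h2)⟩
        rw [h1] at h2; exact Sum.inr_ne_inl h2
      rw [← Finset.card_biUnion hpd, ← Finset.card_union_of_disjoint hd1, ← Finset.card_union_of_disjoint hd2]
      exact Finset.card_le_card (Finset.union_subset (Finset.union_subset (Finset.biUnion_subset.2 fun a _ =>
        Finset.filter_subset _ _) (Finset.filter_subset _ _)) (Finset.filter_subset _ _))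
    simp only [hE, hB, Finset.sum_const, Finset.card_univ, Fintype.card_fin, smul_eq_mul, mul_one, hcard] at hle'
    omega

/-! ### Elementary properties of five parts -/

/-- Every point of a five part of slot `m`, sign `b` lies over a label `(m, a, b)`. [folklore] -/
theorem IsFivePartD.exists_eq_inr {m : Fin 2} {b : Bool} {G : Finset α} (hG : IsFivePartD v m b G) {x : α} (hx : x ∈ G) :
    ∃ a : Fin 5, v x = Sum.inr (m, (a, b)) := by
  classical
  have hpos : 0 < (G.filter fun x' => v x' = v x).card := Finset.card_pos.2 ⟨x, Finset.mem_filter.2 ⟨hx, rfl⟩⟩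
  rw [hG.count_eq] at hpos
  by_contra h
  rw [if_neg h] at hpos
  exact lt_irrefl 0 hpos

/-- A pair part is non-empty. [folklore] -/
theorem IsPairPartD.nonempty {G : Finset α} (hG : IsPairPartD v G) : G.Nonempty := by
  obtain ⟨_, hcard, -⟩ := hG
  rw [← Finset.card_pos, hcard]; norm_num

/-- The model map is injective on a five part. [folklore] -/
theorem IsFivePartD.injOn {m : Fin 2} {b : Bool} {G : Finset α} (hG : IsFivePartD v m b G) : Set.InjOn v ↑G := by
  classical
  intro x hx x' hx' h
  have hle : (G.filter fun y => v y = v x).card ≤ 1 := by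
    rw [hG.count_eq]; split_ifs <;> omega
  exact Finset.card_le_one.1 hle x (Finset.mem_filter.2 ⟨hx, rfl⟩) x' (Finset.mem_filter.2 ⟨hx', h.symm⟩)

/-- A five part is non-empty. [folklore] -/
theorem IsFivePartD.nonempty {m : Fin 2} {b : Bool} {G : Finset α} (hG : IsFivePartD v m b G) : G.Nonempty := by
  rw [← Finset.card_pos, hG.1]; norm_num

/-- A five part inside `T` from the counts: one point over each `(m, a, b)`. [folklore] -/
theorem exists_fivePartD_of_counts [DecidableEq α] {T : Finset α} (m : Fin 2) (b : Bool)
    (hB : ∀ a : Fin 5, 0 < (T.filter fun x => v x = Sum.inr (m, (a, b))).card) : ∃ G ⊆ T, IsFivePartD v m b G := by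
  have hpick : ∀ a : Fin 5, ∃ x ∈ T, v x = Sum.inr (m, (a, b)) := fun a => by
    obtain ⟨x, hx⟩ := Finset.card_pos.1 (hB a)
    exact ⟨x, (Finset.mem_filter.1 hx).1, (Finset.mem_filter.1 hx).2⟩
  choose pick hpickT hpickv using hpick
  have hpinj : Function.Injective pick := fun a a' h => by
    have e := hpickv a
    rw [h, hpickv a'] at e
    have : a' = a := by simpa using e
    exact this.symm
  refine ⟨univ.image pick, fun x hx => by obtain ⟨a, -, rfl⟩ := Finset.mem_image.1 hx; exact hpickT a, ?_, fun a => ?_⟩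
  · rw [Finset.card_image_of_injective _ hpinj, Finset.card_univ, Fintype.card_fin]
  · rw [Finset.card_eq_one]
    refine ⟨pick a, ?_⟩
    ext x
    simp only [Finset.mem_filter, Finset.mem_image, Finset.mem_univ, true_and, Finset.mem_singleton]
    constructor
    · rintro ⟨⟨a', rfl⟩, hvx⟩
      rw [hpickv a'] at hvx
      have : a' = a := by simpa using hvx
      rw [this]
    · rintro rfl
      exact ⟨⟨a, rfl⟩, hpickv a⟩

/-- A pair part inside `T` from the counts: one point over `y` and one over `cjD y`. [folklore] -/
theorem exists_pairPartD_of_counts [DecidableEq α] {T : Finset α} (y : PtD)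
    (hy : 0 < (T.filter fun x => v x = y).card) (hcy : 0 < (T.filter fun x => v x = cjD y).card) :
    ∃ G ⊆ T, IsPairPartD v G := by
  obtain ⟨x, hx₀⟩ := Finset.card_pos.1 hy
  obtain ⟨hxT, hx⟩ := Finset.mem_filter.1 hx₀
  obtain ⟨x', hx₀'⟩ := Finset.card_pos.1 hcy
  obtain ⟨hx'T, hx'⟩ := Finset.mem_filter.1 hx₀'
  have hne : x ≠ x' := by
    intro h
    apply cjD_facts.2 y
    rw [← hx', ← h, hx]
  refine ⟨{x, x'}, ?_, y, Finset.card_pair hne, ?_, ?_⟩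
  · intro z hz
    rcases Finset.mem_insert.1 hz with rfl | hz
    · exact hxT
    · rw [Finset.mem_singleton.1 hz]; exact hx'T
  · intro z hz z' hz' hzz'
    simp only [Finset.coe_insert, Finset.coe_singleton, Set.mem_insert_iff, Set.mem_singleton_iff] at hz hz'
    rcases hz with rfl | rfl <;> rcases hz' with rfl | rfl
    · rfl
    · exfalso; rw [hx, hx'] at hzz'; exact cjD_facts.2 y hzz'.symm
    · exfalso; rw [hx, hx'] at hzz'; exact cjD_facts.2 y hzz'
    · rfl
  · rw [Finset.image_insert, Finset.image_singleton, hx, hx']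

/-! ### Splitting the sixfold and tenfold parts -/

/-- A sixfold part is its curve point plus a five part. [folklore] -/
theorem IsSixPartD.exists_split [DecidableEq α] {m : Fin 2} {b : Bool} {G : Finset α} (hG : IsSixPartD v m b G) :
    ∃ (x : α) (G₁ : Finset α), x ∉ G₁ ∧ G = insert x G₁ ∧ v x = Sum.inl b ∧ IsFivePartD v m b G₁ := by
  obtain ⟨x, hxf⟩ := Finset.card_eq_one.1 hG.2.1
  have hx : x ∈ G.filter fun x => v x = Sum.inl b := by rw [hxf]; exact Finset.mem_singleton_self x
  obtain ⟨hxG, hvx⟩ := Finset.mem_filter.1 hx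
  obtain ⟨W, hW, hW'⟩ := exists_fivePartD_of_counts (v := v) (T := G) m b fun a => by rw [hG.2.2 a]; exact one_pos
  have hxW : x ∉ W := fun h => by
    obtain ⟨a, ha⟩ := hW'.exists_eq_inr h
    rw [hvx] at ha; exact Sum.inl_ne_inr ha
  refine ⟨x, W, hxW, ?_, hvx, hW'⟩
  symm
  apply Finset.eq_of_subset_of_card_le (Finset.insert_subset hxG hW)
  rw [Finset.card_insert_of_notMem hxW, hW'.1, hG.1]

/-- A tenfold part is two five parts: slot `0`, sign `b` and slot `1`, sign `¬b`. [folklore] -/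
theorem IsTenPartD.exists_split [DecidableEq α] {b : Bool} {G : Finset α} (hG : IsTenPartD v b G) :
    ∃ G₀ G₁ : Finset α, Disjoint G₀ G₁ ∧ G = G₀ ∪ G₁ ∧ IsFivePartD v 0 b G₀ ∧ IsFivePartD v 1 (!b) G₁ := by
  obtain ⟨W₀, hW₀, hW₀'⟩ := exists_fivePartD_of_counts (v := v) (T := G) 0 b fun a => by rw [hG.2.1 a]; exact one_pos
  obtain ⟨W₁, hW₁, hW₁'⟩ := exists_fivePartD_of_counts (v := v) (T := G) 1 (!b) fun a => by rw [hG.2.2 a]; exact one_pos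
  have hW : Disjoint W₀ W₁ := by
    rw [Finset.disjoint_left]
    intro x hx0 hx1
    obtain ⟨a, ha⟩ := hW₀'.exists_eq_inr hx0
    obtain ⟨a', ha'⟩ := hW₁'.exists_eq_inr hx1
    have := ha.symm.trans ha'
    simp at this
  refine ⟨W₀, W₁, hW, ?_, hW₀', hW₁'⟩
  symm
  apply Finset.eq_of_subset_of_card_le (Finset.union_subset hW₀ hW₁)
  rw [Finset.card_union_of_disjoint hW, hW₀'.1, hW₁'.1, hG.1]

/-- The count function of a tenfold part: `1` on the five `(0, a, b)` and the five `(1, a, ¬b)`, `0` elsewhere. [folklore] -/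
theorem IsTenPartD.count_eq [DecidableEq α] {b : Bool} {G : Finset α} (hG : IsTenPartD v b G) (z : PtD) :
    (G.filter fun x => v x = z).card =
      if (∃ a : Fin 5, z = Sum.inr (0, (a, b))) ∨ ∃ a : Fin 5, z = Sum.inr (1, (a, !b)) then 1 else 0 := by
  obtain ⟨G₀, G₁, hd, rfl, h₀, h₁⟩ := hG.exists_split
  rw [Finset.filter_union, Finset.card_union_of_disjoint (Finset.disjoint_filter_filter hd), h₀.count_eq, h₁.count_eq]
  by_cases hz0 : ∃ a : Fin 5, z = Sum.inr (0, (a, b))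
  · have hz1 : ¬ ∃ a : Fin 5, z = Sum.inr (1, (a, !b)) := fun ⟨a, ha⟩ => by
      obtain ⟨a', ha'⟩ := hz0; rw [ha'] at ha; simp at ha
    rw [if_pos hz0, if_neg hz1, if_pos (Or.inl hz0)]
  · by_cases hz1 : ∃ a : Fin 5, z = Sum.inr (1, (a, !b))
    · rw [if_neg hz0, if_pos hz1, if_pos (Or.inr hz1)]
    · rw [if_neg hz0, if_neg hz1, if_neg (fun h => h.elim hz0 hz1)]

/-! ### The parts are balanced -/

/-- **A pair part is balanced.** [cite: Gordon1999HodgeAVSurvey, 9.2.2] -/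
theorem IsPairPartD.modelBalancedD [DecidableEq α] {G : Finset α} (hG : IsPairPartD v G) : ModelBalancedD c v G := by
  obtain ⟨y, hy⟩ := hG.count_eq
  intro r
  rw [card_filter_mem_eq_sumD, card_eq_sumD v G]
  simp only [hy]
  have key : ∀ (c : Bool) (y : PtD) (r : Fin 60), 2 * ∑ z ∈ phiD c r, (if z = y ∨ z = cjD y then 1 else 0) =
      ∑ z : PtD, (if z = y ∨ z = cjD y then 1 else 0) := by
    unfold phiD inPhiD signTabD inPos
    decide +kernel
  exact key c y r

/-- **A sixfold part is balanced** (three of its six points lie in each `ρ_r⁻¹(type)`: the Weil class of `B_m × E` is a Hodge class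
for every conjugate type). [cite: MoonenZarhin1995Duke, Thm. 2.4] -/
theorem IsSixPartD.modelBalancedD {m : Fin 2} {b : Bool} {G : Finset α} (hG : IsSixPartD v m b G) : ModelBalancedD c v G := by
  classical
  intro r
  rw [card_filter_mem_eq_sumD, card_eq_sumD v G]
  simp only [hG.count_eq]
  have key : ∀ (c : Bool) (m : Fin 2) (b : Bool) (r : Fin 60),
      2 * ∑ z ∈ phiD c r, (if z = Sum.inl b then 1 else if ∃ a : Fin 5, z = Sum.inr (m, (a, b)) then 1 else 0) =
        ∑ z : PtD, (if z = Sum.inl b then 1 else if ∃ a : Fin 5, z = Sum.inr (m, (a, b)) then 1 else 0) := by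
    unfold phiD inPhiD signTabD inPos
    decide +kernel
  exact key c m b r

/-- **A tenfold part is balanced** (five of its ten points lie in each `ρ_r⁻¹(type)`: two `(0,a,b)` and three `(1,a,¬b)`, or three
and two). [cite: MoonenZarhin1995Duke, Thm. 2.4] -/
theorem IsTenPartD.modelBalancedD [DecidableEq α] {b : Bool} {G : Finset α} (hG : IsTenPartD v b G) : ModelBalancedD c v G := by
  intro r
  rw [card_filter_mem_eq_sumD, card_eq_sumD v G]
  simp only [hG.count_eq]
  have key : ∀ (c : Bool) (b : Bool) (r : Fin 60),
      2 * ∑ z ∈ phiD c r, (if (∃ a : Fin 5, z = Sum.inr (0, (a, b))) ∨ ∃ a : Fin 5, z = Sum.inr (1, (a, !b)) then 1 else 0) =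
        ∑ z : PtD, (if (∃ a : Fin 5, z = Sum.inr (0, (a, b))) ∨ ∃ a : Fin 5, z = Sum.inr (1, (a, !b)) then 1 else 0) := by
    unfold phiD inPhiD signTabD inPos
    decide +kernel
  exact key c b r

/-! ### Elementary properties of the sixfold and tenfold parts -/

/-- Every point of a sixfold part lies over `inl b` or over a label `(m, a, b)`. [folklore] -/
theorem IsSixPartD.mem_cases {m : Fin 2} {b : Bool} {G : Finset α} (hG : IsSixPartD v m b G) {x : α} (hx : x ∈ G) :
    v x = Sum.inl b ∨ ∃ a : Fin 5, v x = Sum.inr (m, (a, b)) := by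
  classical
  have hpos : 0 < (G.filter fun x' => v x' = v x).card := Finset.card_pos.2 ⟨x, Finset.mem_filter.2 ⟨hx, rfl⟩⟩
  rw [hG.count_eq] at hpos
  by_contra h
  push Not at h
  rw [if_neg h.1, if_neg (fun ⟨a, ha⟩ => h.2 a ha)] at hpos
  exact lt_irrefl 0 hpos

/-- The model map is injective on a sixfold part (one point over each of its six labels). [folklore] -/
theorem IsSixPartD.injOn {m : Fin 2} {b : Bool} {G : Finset α} (hG : IsSixPartD v m b G) : Set.InjOn v ↑G := by
  classical
  intro x hx x' hx' h
  have hle : (G.filter fun y => v y = v x).card ≤ 1 := by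
    rw [hG.count_eq]; split_ifs <;> omega
  exact Finset.card_le_one.1 hle x (Finset.mem_filter.2 ⟨hx, rfl⟩) x' (Finset.mem_filter.2 ⟨hx', h.symm⟩)

/-- The model image of a sixfold part: `{inl b} ⊔ {(m, a, b) | a}`. [folklore] -/
theorem IsSixPartD.image_eq [DecidableEq α] {m : Fin 2} {b : Bool} {G : Finset α} (hG : IsSixPartD v m b G) :
    G.image v = insert (Sum.inl b) ((univ : Finset (Fin 5)).image fun a => (Sum.inr (m, (a, b)) : PtD)) := by
  ext y
  simp only [Finset.mem_image, Finset.mem_insert, Finset.mem_univ, true_and]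
  constructor
  · rintro ⟨x, hx, rfl⟩
    rcases hG.mem_cases hx with h | ⟨a, ha⟩
    · exact Or.inl h
    · exact Or.inr ⟨a, ha.symm⟩
  · rintro (rfl | ⟨a, rfl⟩)
    · obtain ⟨z, hz⟩ := Finset.card_eq_one.1 hG.2.1
      have hz' : z ∈ G.filter fun x => v x = Sum.inl b := by rw [hz]; exact Finset.mem_singleton_self z
      exact ⟨z, (Finset.mem_filter.1 hz').1, (Finset.mem_filter.1 hz').2⟩
    · obtain ⟨z, hz⟩ := Finset.card_eq_one.1 (hG.2.2 a)
      have hz' : z ∈ G.filter fun x => v x = Sum.inr (m, (a, b)) := by rw [hz]; exact Finset.mem_singleton_self z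
      exact ⟨z, (Finset.mem_filter.1 hz').1, (Finset.mem_filter.1 hz').2⟩

/-- A sixfold part is non-empty. [folklore] -/
theorem IsSixPartD.nonempty {m : Fin 2} {b : Bool} {G : Finset α} (hG : IsSixPartD v m b G) : G.Nonempty := by
  rw [← Finset.card_pos, hG.1]; norm_num

/-- Every point of a tenfold part lies over a label `(0, a, b)` or `(1, a, ¬b)`. [folklore] -/
theorem IsTenPartD.mem_cases {b : Bool} {G : Finset α} (hG : IsTenPartD v b G) {x : α} (hx : x ∈ G) :
    (∃ a : Fin 5, v x = Sum.inr (0, (a, b))) ∨ ∃ a : Fin 5, v x = Sum.inr (1, (a, !b)) := by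
  classical
  have hpos : 0 < (G.filter fun x' => v x' = v x).card := Finset.card_pos.2 ⟨x, Finset.mem_filter.2 ⟨hx, rfl⟩⟩
  rw [hG.count_eq] at hpos
  by_contra h
  rw [if_neg h] at hpos
  exact lt_irrefl 0 hpos

/-- The model map is injective on a tenfold part. [folklore] -/
theorem IsTenPartD.injOn {b : Bool} {G : Finset α} (hG : IsTenPartD v b G) : Set.InjOn v ↑G := by
  classical
  intro x hx x' hx' h
  have hle : (G.filter fun y => v y = v x).card ≤ 1 := by
    rw [hG.count_eq]; split_ifs <;> omega
  exact Finset.card_le_one.1 hle x (Finset.mem_filter.2 ⟨hx, rfl⟩) x' (Finset.mem_filter.2 ⟨hx', h.symm⟩)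

/-- A tenfold part is non-empty. [folklore] -/
theorem IsTenPartD.nonempty {b : Bool} {G : Finset α} (hG : IsTenPartD v b G) : G.Nonempty := by
  rw [← Finset.card_pos, hG.1]; norm_num

end Summit.HodgeConjecture.CorCM.Census.DecicWeil23Pair
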